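import Mathlib
import Summits.HodgeConjecture.FermatCycles.HodgeFermatLemmaEMu

/-!
# LEMMA E (ν-part, m₀ = 3) for characters ramified at 3 (`HodgeFermat/LemmaENu.lean`)

Tree copy (whole module) of the module `HodgeFermat/LemmaENu.lean` of the sibling cell's standalone package
`run/shared/lean/pub/pub-hodgefermat/lean/HodgeFermat/` (196 lines, sha256 `a8c5b4d3710817d9…`), source lines 29–196 (all).
Filed by cell `pub-hfermat`, seat prover-1 gen-0, on the COORDINATOR KEEPER RULING of 2026-08-25 (gem sweep H1: take the
off-gate kernel theorem `thmFstar` — `HodgeFermat/DecodingFinal.lean:29` — through the gate); this file is one link of the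
minimal import closure of `thmFstar`.  The source module's declarations are VERBATIM those of the cell record
`check/DecodingFinal_standalone.lean` (27 bodies, 454 223 B, sha256 dca6f17de93119a6…, hub `lean check` rc 0, 130.1 s; pub-hodgefermat `CERT.md` l.978, GATE HF-G32).
Deviations from the source module, exhaustively: the `import` lines (tree modules `Summits.HodgeConjecture.FermatCycles.
HodgeFermat*` instead of `HodgeFermat.*`); this module docstring; the explicit `open HodgeFermat.KRFree.LemmaEMu (…)` list (source l.33–34) loses the name `ne_one_of_odd` (deleted from `HodgeFermatLemmaEMu.lean` as a duplicate of `Literature.NumberTheory.LFunctions.BernoulliOneOdd.ne_one_of_odd`; it is not used in this module); one-line docstring added (gate lint) to `nuw_toFun`.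
Every other line — in particular every declaration's statement and proof — is byte-identical to the source.
HONEST FRAMING: explicit algebraic cycles for specific Hodge classes on Fermat/Delsarte varieties; residual open instances
listed; no claim on general Hodge.  (This file is arithmetic of CM types; it claims nothing about cycles.)

The source module's docstring (LemmaENu.lean l.3–27), verbatim:

## LEMMA E (ν-part, m₀ = 3) at a prime level: characters of conductor `3p` (HF-G31d)

`HodgeFermat/TwistedMoment.lean` (HF-G31b) proves the ν-IDENTITY of LEMMA E (`tables/DPRIME-THEOREM.md` §6, `m₀ = 3`)
in algebraic form: for a character `χ` mod `3n` "ramified at 3" (`χ(j) − 1` cancels for the unit `j ≡ 2 (3)`,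
`j ≡ 1 (n)`) and two zero-sum triples of the same CM type, `S_{3n}(χ)·Σ_{x ∈ T, 3 ∤ x} χ̄(x) = S_{3n}(χ)·Σ_{T′} …`
(`nu_identity`).  LEMMA E proper — `ν̂_T(χ̄) = ν̂_T′(χ̄)` — needs the CANCELLATION `S_{3n}(χ) ≠ 0`.

THIS FILE performs it at the prime levels `m₁ = p` (`p ≠ 3` prime) for every ODD Dirichlet character
`χ : DirichletCharacter ℂ (3 * p)` that factors neither through `ℤ/p` nor through `ℤ/3` — exactly the characters
`χ₃^± × ψ`, `ψ` even and non-trivial mod `p`, of DPRIME §7.1 ("ν̂(ψ) = 0 for all even ψ ≠ 1"):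
* `isPrimitive_three_mul`: such a `χ` is PRIMITIVE (conductor `3p`; Mathlib's `factorsThrough_iff_ker_unitsMap` and the
  divisors of `3p`);
* `moment_eq_LFunction`: `S_N(χ) = -N·L(χ, 0)` for an odd `χ` at ANY level `N` (from `H0`, as in `LemmaEMu`);
* `moment_ne_zero₃ (h0 : H0) (hp : p.Prime) (χ) (hχ : χ.Odd) (hA) (hB) : moment (3 * p) (toFun χ) ≠ 0` (`LemmaEMu.lfunction_zero_ne_zero`);
* `lemmaE_nu (h0 : H0) (hp : p.Prime) (hp3 : p ≠ 3) (χ : DirichletCharacter ℂ (3 * p)) (hχ : χ.Odd) (hram) (hB) …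
  (hT : SameType (3 * p) (a, b, c) (a', b', c')) : nhat χ a + nhat χ b + nhat χ c = nhat χ a' + nhat χ b' + nhat χ c'`
  with the ν-weight `nhat χ x = χ⁻¹(x)` (`3 ∤ x`), `0` (`3 ∣ x`) — for two zero-sum triples mod `3p` with entries prime
  to `p` and the same CM type.
`HodgeFermat/LemmaENuFinal.lean` discharges `h0` by `HurwitzZero.hypH0` (heavy import, separate record).

LIGHT module: imports `LemmaEMu` (cone LemmaN → ChiThree → TwistedMoment → LemmaEMu); no `sorry`; no `decide`;
axioms [propext, Classical.choice, Quot.sound] (hub record `check/NuChar_standalone.lean` — 6 bodies, this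
module and its instance `NuChar` — JSON under `results/gen31/local/lean/`).  NOT imported by the root `HodgeFermat.lean`.
-/

namespace HodgeFermat.KRFree.LemmaENu

open Finset HodgeFermat.KRFree.LemmaN HodgeFermat.KRFree.TwistedMoment HurwitzZeta
open HodgeFermat.KRFree.ChiThree (units)
open HodgeFermat.KRFree.LemmaEMu (H0 toFun toFun_isChar toFun_one toFun_mul_inv lfunction_zero_of_odd
  lfunction_zero_ne_zero)

section dictionary

variable {N : ℕ}

/-- the ν-weight of (E0) for a character `χ` ramified at `3`: `χ⁻¹(x)` if `3 ∤ x`, `0` if `3 ∣ x` -/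
noncomputable def nhat (χ : DirichletCharacter ℂ N) (x : ℕ) : ℂ :=
  if 3 ∣ x then 0 else χ⁻¹ (x : ZMod N)

/-- dictionary: `nuw (toFun χ⁻¹) = nhat χ` -/
lemma nuw_toFun (χ : DirichletCharacter ℂ N) (x : ℕ) : nuw (toFun χ⁻¹) x = nhat χ x := by
  unfold nuw nhat toFun
  rfl

variable [NeZero N]

/-- `S_N(χ) = Σ_{j : ZMod N} χ(j)·val(j)` at any level (`χ` vanishes off the units) -/
lemma moment_toFun_eq (χ : DirichletCharacter ℂ N) :
    moment N (toFun χ) = ∑ j : ZMod N, χ j * ((j.val : ℕ) : ℂ) := by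
  unfold moment toFun
  have h1 : ∑ u ∈ units N, χ ((u : ℕ) : ZMod N) * (u : ℂ)
      = ∑ t ∈ range N, χ ((t : ℕ) : ZMod N) * (t : ℂ) := by
    unfold units
    rw [Finset.sum_filter]
    refine Finset.sum_congr rfl (fun t _ => ?_)
    by_cases h : Nat.Coprime t N
    · simp [h]
    · rw [if_neg h]
      have hnu : ¬ IsUnit ((t : ℕ) : ZMod N) := fun hu => h ((ZMod.isUnit_iff_coprime t N).mp hu)
      rw [MulChar.map_nonunit _ hnu, zero_mul]
  rw [h1]
  refine Finset.sum_nbij' (fun t => ((t : ℕ) : ZMod N)) (fun j => j.val) ?_ ?_ ?_ ?_ ?_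
  · intro t _; exact mem_univ _
  · intro j _; exact mem_range.mpr (ZMod.val_lt j)
  · intro t ht
    exact ZMod.val_natCast_of_lt (mem_range.mp ht)
  · intro j _; exact ZMod.natCast_zmod_val j
  · intro t ht
    rw [ZMod.val_natCast_of_lt (mem_range.mp ht)]

/-- `S_N(χ) = -N · L(χ, 0)` for an odd character `χ` at any level `N` (from H0). -/
theorem moment_eq_LFunction (h0 : H0) (χ : DirichletCharacter ℂ N) (hχ : χ.Odd) :
    moment N (toFun χ) = -(N : ℂ) * χ.LFunction 0 := by
  rw [moment_toFun_eq, DirichletCharacter.LFunction, lfunction_zero_of_odd h0 hχ.to_fun]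
  have hN0 : (N : ℂ) ≠ 0 := Nat.cast_ne_zero.mpr (NeZero.ne N)
  field_simp

end dictionary

/-! ## Primitivity at level `3p` -/

section level3p

variable {p : ℕ}

/-- if `χ` mod `3p` factors through `d ∣ 3p`, then `χ(u) = 1` for every unit `u ≡ 1 (mod d)` -/
lemma apply_eq_one_of_factorsThrough [NeZero (3 * p)] (χ : DirichletCharacter ℂ (3 * p)) {d : ℕ}
    (hd : d ∣ 3 * p) (hf : χ.FactorsThrough d) {u : ℕ} (hu : Nat.Coprime u (3 * p)) (hmod : u % d = 1 % d) :
    χ (u : ZMod (3 * p)) = 1 := by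
  have hker := (DirichletCharacter.factorsThrough_iff_ker_unitsMap hd).mp hf
  have hU : ZMod.unitOfCoprime u hu ∈ (ZMod.unitsMap hd).ker := by
    rw [MonoidHom.mem_ker, Units.ext_iff, ZMod.unitsMap_val, ZMod.coe_unitOfCoprime, Units.val_one,
      ZMod.cast_natCast hd]
    have h1 : ((u : ℕ) : ZMod d) = ((1 : ℕ) : ZMod d) := (ZMod.natCast_eq_natCast_iff' u 1 d).mpr hmod
    rw [h1, Nat.cast_one]
  have h1 := hker hU
  rw [MonoidHom.mem_ker, Units.ext_iff, MulChar.coe_toUnitHom, ZMod.coe_unitOfCoprime, Units.val_one] at h1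
  exact h1

/-- **Primitivity.**  A character mod `3p` (`p` prime) which is `≠ 1` at some unit `≡ 1 (mod p)` and at some
unit `≡ 1 (mod 3)` factors neither through `p` nor through `3`, hence has conductor `3p`. -/
theorem isPrimitive_three_mul (hp : p.Prime) (χ : DirichletCharacter ℂ (3 * p))
    (hA : ∃ j : ℕ, Nat.Coprime j (3 * p) ∧ j % p = 1 % p ∧ χ (j : ZMod (3 * p)) ≠ 1)
    (hB : ∃ k : ℕ, Nat.Coprime k (3 * p) ∧ k % 3 = 1 ∧ χ (k : ZMod (3 * p)) ≠ 1) :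
    χ.IsPrimitive := by
  haveI : NeZero (3 * p) := ⟨Nat.mul_ne_zero (by norm_num) hp.ne_zero⟩
  have nP : ¬ χ.conductor ∣ p := by
    intro h
    have hf : χ.FactorsThrough p :=
      (DirichletCharacter.mem_conductorSet_iff_conductor_dvd χ (dvd_mul_left p 3)).mpr h
    obtain ⟨j, hj, hjp, hne⟩ := hA
    exact hne (apply_eq_one_of_factorsThrough χ (dvd_mul_left p 3) hf hj hjp)
  have n3 : ¬ χ.conductor ∣ 3 := by
    intro h
    have hf : χ.FactorsThrough 3 :=
      (DirichletCharacter.mem_conductorSet_iff_conductor_dvd χ (dvd_mul_right 3 p)).mpr h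
    obtain ⟨k, hk, hk3, hne⟩ := hB
    exact hne (apply_eq_one_of_factorsThrough χ (dvd_mul_right 3 p) hf hk (by rw [hk3]))
  rw [DirichletCharacter.isPrimitive_def]
  have hc : χ.conductor ∣ 3 * p := DirichletCharacter.conductor_dvd_level χ
  by_cases hpc : p ∣ χ.conductor
  · obtain ⟨e, he⟩ := hpc
    have he3 : e ∣ 3 := by
      have h' : p * e ∣ p * 3 := by rw [← he, mul_comm p 3]; exact hc
      exact Nat.dvd_of_mul_dvd_mul_left hp.pos h'
    rcases (Nat.dvd_prime Nat.prime_three).mp he3 with h1 | h3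
    · exfalso; apply nP; rw [he, h1, mul_one]
    · rw [he, h3, mul_comm]
  · exfalso
    have hcop : Nat.Coprime χ.conductor p :=
      Nat.coprime_comm.mp ((Nat.Prime.coprime_iff_not_dvd hp).mpr hpc)
    exact n3 (hcop.dvd_of_dvd_mul_right hc)

/-- `S_{3p}(χ) ≠ 0` for such an odd `χ` (from H0): the character `χ` is not Bad for LEMMA E. -/
theorem moment_ne_zero₃ (h0 : H0) (hp : p.Prime) (χ : DirichletCharacter ℂ (3 * p))
    (hχ : χ.Odd)
    (hA : ∃ j : ℕ, Nat.Coprime j (3 * p) ∧ j % p = 1 % p ∧ χ (j : ZMod (3 * p)) ≠ 1)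
    (hB : ∃ k : ℕ, Nat.Coprime k (3 * p) ∧ k % 3 = 1 ∧ χ (k : ZMod (3 * p)) ≠ 1) :
    moment (3 * p) (toFun χ) ≠ 0 := by
  haveI : NeZero (3 * p) := ⟨Nat.mul_ne_zero (by norm_num) hp.ne_zero⟩
  rw [moment_eq_LFunction h0 χ hχ]
  exact mul_ne_zero (neg_ne_zero.mpr (Nat.cast_ne_zero.mpr (NeZero.ne (3 * p))))
    (lfunction_zero_ne_zero χ (isPrimitive_three_mul hp χ hA hB) hχ)

end level3p

/-! ## LEMMA E, ν-part, `m₀ = 3`, prime level -/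

/-- **LEMMA E (ν-part, m₀ = 3, prime level; from H0).**  Let `p ≠ 3` be a prime and `χ` an ODD Dirichlet character
mod `3p` with `χ(j) ≠ 1` at the units `j ≡ 2 (mod 3)`, `j ≡ 1 (mod p)` (ramified at `3`) and `χ(k) ≠ 1` at some unit
`k ≡ 1 (mod 3)` (not a character of `ℤ/3`) — i.e. `χ = χ₃^± × ψ` with `ψ ≠ 1` even mod `p`.  Let `T = (a, b, c)`,
`T′ = (a′, b′, c′)` have zero sums mod `3p`, all entries prime to `p`, and the same CM type at level `3p`.  Then
`Σ_{x ∈ T, 3 ∤ x} χ⁻¹(x) = Σ_{x ∈ T′, 3 ∤ x} χ⁻¹(x)` — i.e. `ν̂_T(χ̄) = ν̂_T′(χ̄)`. -/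
theorem lemmaE_nu (h0 : H0) {p : ℕ} (hp : p.Prime) (hp3 : p ≠ 3) (χ : DirichletCharacter ℂ (3 * p))
    (hχ : χ.Odd)
    (hram : ∀ j : ℕ, Nat.Coprime j (3 * p) → j % 3 = 2 → j % p = 1 % p → χ (j : ZMod (3 * p)) ≠ 1)
    (hB : ∃ k : ℕ, Nat.Coprime k (3 * p) ∧ k % 3 = 1 ∧ χ (k : ZMod (3 * p)) ≠ 1)
    {a b c a' b' c' : ℕ} (hs : 3 * p ∣ a + b + c) (hs' : 3 * p ∣ a' + b' + c')
    (ha : Nat.Coprime a p) (hb : Nat.Coprime b p) (hc : Nat.Coprime c p)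
    (ha' : Nat.Coprime a' p) (hb' : Nat.Coprime b' p) (hc' : Nat.Coprime c' p)
    (hT : SameType (3 * p) (a, b, c) (a', b', c')) :
    nhat χ a + nhat χ b + nhat χ c = nhat χ a' + nhat χ b' + nhat χ c' := by
  haveI : NeZero (3 * p) := ⟨Nat.mul_ne_zero (by norm_num) hp.ne_zero⟩
  have h1p : 1 < p := hp.one_lt
  have h3p : ¬ 3 ∣ p := fun h => hp3 ((Nat.prime_dvd_prime_iff_eq Nat.prime_three hp).mp h).symm
  -- the ramification hypothesis in the regular form of `nu_identity`
  have hram' : ∀ j, Nat.Coprime j (3 * p) → j % 3 = 2 → j % p = 1 % p →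
      ∀ z : ℂ, toFun χ j * z = z → z = 0 := by
    intro j hj hj3 hjp z hz
    have hne : toFun χ j - 1 ≠ 0 := sub_ne_zero.mpr (hram j hj hj3 hjp)
    have h0' : (toFun χ j - 1) * z = 0 := by rw [sub_mul, one_mul, hz, sub_self]
    rcases mul_eq_zero.mp h0' with h | h
    · exact absurd h hne
    · exact h
  have hA : ∃ j : ℕ, Nat.Coprime j (3 * p) ∧ j % p = 1 % p ∧ χ (j : ZMod (3 * p)) ≠ 1 := by
    obtain ⟨j, hj, hj3, hjp⟩ := exists_unit h3p
    exact ⟨j, hj, hjp, hram j hj hj3 hjp⟩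
  -- entries: prime to `p` ⟹ divisible by 3 or units mod 3p; third entries nonzero mod 3p
  have lift : ∀ {x : ℕ}, Nat.Coprime x p → 3 ∣ x ∨ Nat.Coprime x (3 * p) := by
    intro x hx
    by_cases h3 : 3 ∣ x
    · exact Or.inl h3
    · exact Or.inr (coprime_three_mul_iff.mpr ⟨h3, hx⟩)
  have nz : ∀ {x : ℕ}, Nat.Coprime x p → ¬ 3 * p ∣ x := by
    intro x hx h
    have hpx : p ∣ x := dvd_trans (dvd_mul_left p 3) h
    exact absurd ((Nat.coprime_comm.mp hx).eq_one_of_dvd hpx) hp.one_lt.ne'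
  have key := nu_identity (toFun_isChar χ) hp.pos h3p (fun x hx => toFun_mul_inv χ hx) hram'
    hs hs' (lift ha) (lift hb) (lift hc) (lift ha') (lift hb') (lift hc') (nz hc) (nz hc') hT
  simp only [nuw_toFun] at key
  exact mul_left_cancel₀ (moment_ne_zero₃ h0 hp χ hχ hA hB) key

end HodgeFermat.KRFree.LemmaENu
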